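import Literature.AnabelianGeometry.SemiGraphs.PSCIrreducibleNodalConj
import Literature.AnabelianGeometry.SemiGraphs.PSCIrreducibleNodalOrigin
import HarnessLib

/-!
# [CombGC] Prop. 1.2 (i), [IUTchI] Rmk. 1.2.3 (iv) (cuspidal), [CombGC] Thm. 1.6 (i) at every irreducible one-nodal shape — the one-pointed nodal cubic included

Mochizuki, *A combinatorial version of the Grothendieck conjecture* [CombGC] §1: Prop. 1.2 (i) p. 8, Thm.
1.6 (i) p. 13; *Inter-universal Teichmüller theory I* [IUTchI] Rmk. 1.2.3 (iv) pp. 41–42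
[cite: MochizukiCombGC2007, Thm 1.6(i) p.13] [cite: MochizukiCombGC2007, Prop 1.2(i) p.8]
[cite: Mochizuki2012, IUTchI Rmk 1.2.3(iv) pp.41-42].  PROOF-ONLY assembly (abc-iut-f-164 gen 2; rows F-0459
`PSCDatum.OpenInterDeterminesComponentHolds`, F-1931 `PSCDatum.CuspidalEdgeLikeCharacterizationHolds`, F-0458
`PSCDatum.NumericallyCuspidalIffHolds`) extending `PSCIrreducibleNodalOrigin.lean` (which needed
`2 ≤ g ∨ 2 ≤ r`) to EVERY hyperbolic irreducible one-nodal shape, `g ≥ 1`, `2 ≤ g ∨ 1 ≤ r`, by the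
conjugacy engine of `PSCIrreducibleNodalConj.lean`.

* `openInterDeterminesComponentHolds_of_irreducibleNodal'`, `numericallyCuspidalIffHolds_of_irreducibleNodal'`:
  F-0459 and F-0458 (`Σ = {l}`) at every origin of such data (F-1931: the vertex-free
  `cuspidalEdgeLikeCharacterizationHolds_of_cuspidallyStandard`).
* `exists_nodalCubicOrigin_thm16i_holds`: for a prime `l`, the origin of these data with `Σ = {l}` satisfies
  F-0459 ∧ F-1931 ∧ F-0458 and is INHABITED by the pro-`l` datum of the ONE-POINTED NODAL CUBIC
  (`Γ_{1,1}`: one vertex of genus `0`, one node `closure ι⟨b_0⟩`, one marked point `c_0 = [a_0,b_0]⁻¹`).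

With `PSCTwoComponentAffinePointedOrigin.lean`, `PSCTwoComponentUnmarkedOrigin.lean` and
`PSCIrreducibleNodalOrigin.lean` the three rows now hold in the kernel at EVERY ONE-NODAL pointed stable
curve shape with at least one marked point (strata `Δ_h` and `Δ_irr`, no exception).  Instance forms at data
of the shape of genuine curves; consistency evidence for the typed rows, not the printed theorems for all
pointed stable curves.  Nothing here takes a side on [IUTchIII] Cor. 3.12.
-/

noncomputable section

namespace Literature.AnabelianGeometry.SemiGraphs

open scoped Pointwise
open Literature.GroupTheory.CombinatorialGroupTheory
open SemiGraphOfAnabelioids (IsProSigmaCompletion)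

universe u

namespace PSCDatum

section Origin

variable (Ω : PSCOrigin.{u}) (l : ℕ)

/-- **F-0459 / [CombGC] Prop. 1.2 (i) at every origin whose data are of hyperbolic irreducible one-nodal
shape** (`g ≥ 1`, `2 ≤ g ∨ 1 ≤ r`; profinite `Π`). [cite: MochizukiCombGC2007, Prop 1.2(i) p.8] -/
theorem openInterDeterminesComponentHolds_of_irreducibleNodal'
    (hΩ : ∀ ⦃Q : Type u⦄ [Group Q] [TopologicalSpace Q] [IsTopologicalGroup Q] (G : PSCDatum Q),
      Ω.IsOfPSCType G → CompactSpace Q ∧ T2Space Q ∧ TotallyDisconnectedSpace Q ∧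
        ∃ (S : Set ℕ) (g r : ℕ) (hg : 1 ≤ g) (ι : PuncturedSurfaceGroup g r →* Q) (e : G.graph.C ≃ Fin r)
          (v₀ : G.graph.V) (n₀ : G.graph.N),
          S.Nonempty ∧ (∀ p ∈ S, p.Prime) ∧ IsProSigmaCompletion S ι ∧ (2 ≤ g ∨ 1 ≤ r) ∧
          (∀ c, G.cuspGp c =
            ((PuncturedSurfaceGroup.cuspInertia (g := g) (e c)).map ι).topologicalClosure) ∧
          (∀ w, w = v₀) ∧ (∀ n, n = n₀) ∧
          G.nodeGp n₀ = ((Subgroup.zpowers (PuncturedSurfaceGroup.b (r := r) (⟨0, hg⟩ : Fin g))).map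
            ι).topologicalClosure ∧
          G.vertGp v₀ = ((Subgroup.closure {x : PuncturedSurfaceGroup g r |
            x = PuncturedSurfaceGroup.b ⟨0, hg⟩ ∨
            x = PuncturedSurfaceGroup.a ⟨0, hg⟩ * PuncturedSurfaceGroup.b ⟨0, hg⟩ * (PuncturedSurfaceGroup.a ⟨0, hg⟩)⁻¹ ∨
            (∃ i : Fin g, 1 ≤ (i : ℕ) ∧ (x = PuncturedSurfaceGroup.a i ∨ x = PuncturedSurfaceGroup.b i)) ∨
            ∃ j : Fin r, x = PuncturedSurfaceGroup.c j}).map ι).topologicalClosure ∧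
          G.genus v₀ = g - 1) :
    OpenInterDeterminesComponentHolds Ω := by
  intro Q _ _ _ G hG
  obtain ⟨hc, ht, hd, S, g, r, hg, ι, e, v₀, n₀, hne, hprime, hι, hgr, hC, hV, hN, hE, -, -⟩ := hΩ G hG
  exact G.openInterDeterminesComponent_of_irreducibleNodal' hne hprime ι hι hg hgr e hC v₀ hV n₀ hN hE

/-- **F-0458 / [CombGC] Thm. 1.6 (i) as printed at every origin whose data are of hyperbolic irreducible
one-nodal shape, `Σ = {l}`** (reduction `numericallyCuspidalIffHolds_of_characterization` from F-0459 above
and the vertex-free F-1931). [cite: MochizukiCombGC2007, Thm 1.6(i) p.13] -/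
theorem numericallyCuspidalIffHolds_of_irreducibleNodal'
    (hΩ : ∀ ⦃Q : Type u⦄ [Group Q] [TopologicalSpace Q] [IsTopologicalGroup Q] (G : PSCDatum Q),
      Ω.IsOfPSCType G → CompactSpace Q ∧ T2Space Q ∧ TotallyDisconnectedSpace Q ∧
        ∃ (S : Set ℕ) (g r : ℕ) (hg : 1 ≤ g) (ι : PuncturedSurfaceGroup g r →* Q) (e : G.graph.C ≃ Fin r)
          (v₀ : G.graph.V) (n₀ : G.graph.N),
          S.Nonempty ∧ (∀ p ∈ S, p.Prime) ∧ IsProSigmaCompletion S ι ∧ (2 ≤ g ∨ 1 ≤ r) ∧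
          (∀ c, G.cuspGp c =
            ((PuncturedSurfaceGroup.cuspInertia (g := g) (e c)).map ι).topologicalClosure) ∧
          (∀ w, w = v₀) ∧ (∀ n, n = n₀) ∧
          G.nodeGp n₀ = ((Subgroup.zpowers (PuncturedSurfaceGroup.b (r := r) (⟨0, hg⟩ : Fin g))).map
            ι).topologicalClosure ∧
          G.vertGp v₀ = ((Subgroup.closure {x : PuncturedSurfaceGroup g r |
            x = PuncturedSurfaceGroup.b ⟨0, hg⟩ ∨
            x = PuncturedSurfaceGroup.a ⟨0, hg⟩ * PuncturedSurfaceGroup.b ⟨0, hg⟩ * (PuncturedSurfaceGroup.a ⟨0, hg⟩)⁻¹ ∨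
            (∃ i : Fin g, 1 ≤ (i : ℕ) ∧ (x = PuncturedSurfaceGroup.a i ∨ x = PuncturedSurfaceGroup.b i)) ∨
            ∃ j : Fin r, x = PuncturedSurfaceGroup.c j}).map ι).topologicalClosure ∧
          G.genus v₀ = g - 1)
    (hSig : ∀ ⦃Q : Type u⦄ [Group Q] [TopologicalSpace Q] [IsTopologicalGroup Q] (G : PSCDatum Q),
      Ω.IsOfPSCType G → G.Sigma = {l}) :
    NumericallyCuspidalIffHolds Ω :=
  numericallyCuspidalIffHolds_of_characterization Ω l
    (fun _ _ _ _ G hG => ⟨(hΩ G hG).1, (hΩ G hG).2.2.1⟩) hSig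
    (openInterDeterminesComponentHolds_of_irreducibleNodal' Ω hΩ)
    (cuspidalEdgeLikeCharacterizationHolds_of_cuspidallyStandard Ω fun Q _ _ _ G hG => by
      obtain ⟨hc, ht, hd, S, g, r, hg, ι, e, v₀, n₀, hne, hprime, hι, hgr, hC, -⟩ := hΩ G hG
      exact ⟨hc, ht, hd, S, g, r, ι, e, hne, hprime,
        by unfold PuncturedSurfaceGroup.IsHyperbolicType; omega, hι, hC⟩)

end Origin

/-! ### The origin with `Σ = {l}`, inhabited by the one-pointed nodal cubic -/

/-- **At the origin of hyperbolic irreducible one-nodal data with `Σ = {l}` — inhabited by the pro-`l`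
datum of the ONE-POINTED NODAL CUBIC (`Γ_{1,1}`: one vertex of genus `0`, one node `closure ι⟨b_0⟩`, one
marked point) — F-0459, F-1931 and F-0458 all HOLD.**  Instance forms at data of the shape of genuine
irreducible one-nodal curves, not the printed theorems for all pointed stable curves.
[cite: MochizukiCombGC2007, Thm 1.6(i) p.13] [cite: MochizukiCombGC2007, Prop 1.2(i) p.8]
[cite: Mochizuki2012, IUTchI Rmk 1.2.3(iv) pp.41-42] -/
theorem exists_nodalCubicOrigin_thm16i_holds (l : ℕ) (hl : l.Prime) :
    ∃ Ω : PSCOrigin.{0},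
      (∃ (Q : ProfiniteGrp.{0}) (ι : PuncturedSurfaceGroup 1 1 →* Q) (G : PSCDatum Q)
        (e : G.graph.C ≃ Fin 1) (v₀ : G.graph.V) (n₀ : G.graph.N),
        IsProSigmaCompletion {l} ι ∧ Ω.IsOfPSCType G ∧ G.Sigma = {l} ∧ G.graph.i = 1 ∧ G.graph.n = 1 ∧
          G.graph.r = 1 ∧ (∀ w, w = v₀) ∧ G.genus v₀ = 0 ∧ (∀ n, G.graph.nodeEnds n = s(v₀, v₀)) ∧
          G.nodeGp n₀ = ((Subgroup.zpowers (PuncturedSurfaceGroup.b (r := 1) (0 : Fin 1))).map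
            ι).topologicalClosure ∧
          ∀ c, G.cuspGp c =
            ((PuncturedSurfaceGroup.cuspInertia (g := 1) (e c)).map ι).topologicalClosure) ∧
      OpenInterDeterminesComponentHolds Ω ∧ CuspidalEdgeLikeCharacterizationHolds Ω ∧
      NumericallyCuspidalIffHolds Ω := by
  classical
  let Ω : PSCOrigin.{0} :=
    ⟨fun {Q} _ _ G => ∃ (_ : IsTopologicalGroup Q), G.Sigma = {l} ∧
      (CompactSpace Q ∧ T2Space Q ∧ TotallyDisconnectedSpace Q ∧
        ∃ (S : Set ℕ) (g r : ℕ) (hg : 1 ≤ g) (ι : PuncturedSurfaceGroup g r →* Q) (e : G.graph.C ≃ Fin r)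
          (v₀ : G.graph.V) (n₀ : G.graph.N),
          S.Nonempty ∧ (∀ p ∈ S, p.Prime) ∧ IsProSigmaCompletion S ι ∧ (2 ≤ g ∨ 1 ≤ r) ∧
          (∀ c, G.cuspGp c =
            ((PuncturedSurfaceGroup.cuspInertia (g := g) (e c)).map ι).topologicalClosure) ∧
          (∀ w, w = v₀) ∧ (∀ n, n = n₀) ∧
          G.nodeGp n₀ = ((Subgroup.zpowers (PuncturedSurfaceGroup.b (r := r) (⟨0, hg⟩ : Fin g))).map
            ι).topologicalClosure ∧
          G.vertGp v₀ = ((Subgroup.closure {x : PuncturedSurfaceGroup g r |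
            x = PuncturedSurfaceGroup.b ⟨0, hg⟩ ∨
            x = PuncturedSurfaceGroup.a ⟨0, hg⟩ * PuncturedSurfaceGroup.b ⟨0, hg⟩ * (PuncturedSurfaceGroup.a ⟨0, hg⟩)⁻¹ ∨
            (∃ i : Fin g, 1 ≤ (i : ℕ) ∧ (x = PuncturedSurfaceGroup.a i ∨ x = PuncturedSurfaceGroup.b i)) ∨
            ∃ j : Fin r, x = PuncturedSurfaceGroup.c j}).map ι).topologicalClosure ∧
          G.genus v₀ = g - 1)⟩
  have hΩ : ∀ ⦃Q : Type⦄ [Group Q] [TopologicalSpace Q] [IsTopologicalGroup Q] (G : PSCDatum Q),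
      Ω.IsOfPSCType G → CompactSpace Q ∧ T2Space Q ∧ TotallyDisconnectedSpace Q ∧
        ∃ (S : Set ℕ) (g r : ℕ) (hg : 1 ≤ g) (ι : PuncturedSurfaceGroup g r →* Q) (e : G.graph.C ≃ Fin r)
          (v₀ : G.graph.V) (n₀ : G.graph.N),
          S.Nonempty ∧ (∀ p ∈ S, p.Prime) ∧ IsProSigmaCompletion S ι ∧ (2 ≤ g ∨ 1 ≤ r) ∧
          (∀ c, G.cuspGp c =
            ((PuncturedSurfaceGroup.cuspInertia (g := g) (e c)).map ι).topologicalClosure) ∧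
          (∀ w, w = v₀) ∧ (∀ n, n = n₀) ∧
          G.nodeGp n₀ = ((Subgroup.zpowers (PuncturedSurfaceGroup.b (r := r) (⟨0, hg⟩ : Fin g))).map
            ι).topologicalClosure ∧
          G.vertGp v₀ = ((Subgroup.closure {x : PuncturedSurfaceGroup g r |
            x = PuncturedSurfaceGroup.b ⟨0, hg⟩ ∨
            x = PuncturedSurfaceGroup.a ⟨0, hg⟩ * PuncturedSurfaceGroup.b ⟨0, hg⟩ * (PuncturedSurfaceGroup.a ⟨0, hg⟩)⁻¹ ∨
            (∃ i : Fin g, 1 ≤ (i : ℕ) ∧ (x = PuncturedSurfaceGroup.a i ∨ x = PuncturedSurfaceGroup.b i)) ∨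
            ∃ j : Fin r, x = PuncturedSurfaceGroup.c j}).map ι).topologicalClosure ∧
          G.genus v₀ = g - 1 :=
    fun Q _ _ _ G hG => hG.2.2
  have hSig : ∀ ⦃Q : Type⦄ [Group Q] [TopologicalSpace Q] [IsTopologicalGroup Q] (G : PSCDatum Q),
      Ω.IsOfPSCType G → G.Sigma = {l} := fun Q _ _ _ G hG => hG.2.1
  have hl' : ∀ p ∈ ({l} : Set ℕ), p.Prime := fun p hp => by
    rw [Set.mem_singleton_iff.mp hp]; exact hl
  refine ⟨Ω, ?_, openInterDeterminesComponentHolds_of_irreducibleNodal' Ω hΩ,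
    cuspidalEdgeLikeCharacterizationHolds_of_cuspidallyStandard Ω (fun Q _ _ _ G hG => ?_),
    numericallyCuspidalIffHolds_of_irreducibleNodal' Ω l hΩ hSig⟩
  · obtain ⟨Q, ι, G, e, v₀, n₀, hι, hS, hi, hn, hr, hC, hV, hN, hE, hV₀, hgen, hends⟩ :=
      exists_irreducibleNodalDatum {l} ⟨l, rfl⟩ hl' 1 1 le_rfl
    have hG : Ω.IsOfPSCType G := ⟨inferInstance, hS, inferInstance, inferInstance, inferInstance, {l}, 1, 1,
      le_rfl, ι, e, v₀, n₀, ⟨l, rfl⟩, hl', hι, Or.inr le_rfl, hC, hV, hN, hE, hV₀, hgen⟩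
    exact ⟨Q, ι, G, e, v₀, n₀, hι, hG, hS, hi, hn, hr, hV, hgen, hends, hE, hC⟩
  · obtain ⟨hc, ht, hd, S, g, r, hg, ι, e, v₀, n₀, hne, hprime, hι, hgr, hC, -⟩ := hΩ G hG
    exact ⟨hc, ht, hd, S, g, r, ι, e, hne, hprime,
      by unfold PuncturedSurfaceGroup.IsHyperbolicType; omega, hι, hC⟩

end PSCDatum

end Literature.AnabelianGeometry.SemiGraphs

end
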